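import Literature.AlgebraicGeometry.Resolution.QuadraticTransformsStructure
import Mathlib.Algebra.CharP.Two
import HarnessLib

/-!
# Crux `Steer` (stmt-ResolutionOfSingularities-16345), chain W4.1, hG3 / G-geom WORK-DIRECT: Lemma F♭ PART 3b(B) — FREE-CHAIN COORDINATES
# (ring level: along a chain of RATIONAL FREE quadratic transforms the truncated arc is ALGEBRAIC, and the law telescopes)

OURS (campaign `res-hironaka`, rung L ★L-G4, slot W4.1; seat res-L0-w41-stub-2 g6, res-L0-w41-plan-1 RULINGs 136a/152a/152c; spec =
res-L0-w41-tri-2 `gpd/audit_GPERF_DIRECT.md` §2/§4 (Lemma F / F♭) and res-L0-w41-idea-3 `G-PERF-DIRECT.md` §3 (1)–(3); replaces the role of no printed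
item; NOT a statement of the manuscript under review [claim: Hironaka2017, status: under-review]; AI-produced, weaker than expert review). Theses-free,
definition-free. Vocabulary = the chain words' (`S : ℕ → Subring L` local, `IsQuadraticTransform (S m) (S (m+1))`, exceptional parameters `x m`, the
rationality binder `hrat` of res-D-pv-004/pv-007's Lemma S signature `span_excParam_eq_of_rational`, the freeness conclusion `(x m) = (x (m+1))` of
`NoTangentialStepPerfect`).

* `FreeChain.inclusion_mem_maximalIdeal` — domination: the inclusion of a dominated local subring is local.
* `FreeChain.exists_generators_of_rational_step` — **ONE RATIONAL FREE STEP TRANSPORTS GENERATORS**: if `S ≤ S'` is a quadratic transform with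
  `𝔪_S·S' = u·S'`, `𝔪_S = (u, wᵢ)ᵢ` and every element of `S'` is congruent mod `𝔪_{S'}` to an element of a subset `A ⊆ S` (rationality), then
  `𝔪_{S'} = (u, wᵢ')ᵢ` with `wᵢ = u·(αᵢ + wᵢ')`, `αᵢ ∈ A` (proof: `T := S + J` contains `S[𝔪/u]`; chart change `IsQuadraticTransform.eq_ofPrime_of_le`;
  domination). No regularity, dimension or residue-field hypothesis.
* `FreeChain.exists_sub_mem_maximalIdeal_of_rational` — rationality iterates down to stage `0`.
* `FreeChain.span_excParam_eq_of_free` — under freeness the FIRST exceptional parameter persists: `(x m) = (u)` in `S (m+1)` for all `m`.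
* `FreeChain.exists_coordinates` — **the truncated arc is algebraic**: after `M` rational free steps there are `ỹᵢ ∈ S 0` and `wᵢ ∈ S M` with
  `𝔪₀ = (u, ỹᵢ)ᵢ`, `𝔪_M = (u, wᵢ)ᵢ` and `ỹᵢ = u^M · wᵢ` (the `ỹᵢ` are the arc coordinates `y − Σ_{j<M} a_j x^{j+1}` of the memo, with lifts `a_j ∈ S 0`).
* `FreeChain.exists_telescope` — **the law telescopes** (characteristic `2`, even exponent `2e`): `f 0 = Ψ² + u^(2e·M) · E² · f M` with `Ψ, E ∈ S M`.
* `FreeChain.exists_generator_eq_span` — bookkeeping: a principal ideal generated by the image of `𝔪` is generated by one member of any generating family.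
[folklore]
-/

noncomputable section

set_option linter.dupNamespace false

open IsLocalRing Literature.AlgebraicGeometry.Resolution

namespace Summit.ResolutionOfSingularities.ResolutionOfSingularities.Theorems.SwitchingDichotomy.FreeChain

variable {L : Type*} [Field L]

/-! ## One rational free step -/

section OneStep

variable {S S' : Subring L} [IsLocalRing S] [IsLocalRing S']

/-- Domination makes the inclusion a local map: non-units of `S` stay non-units in `S'`. [folklore] -/
theorem inclusion_mem_maximalIdeal (hdom : SubringDominates S S') {y : S} (hy : y ∈ maximalIdeal S) :
    Subring.inclusion hdom.1 y ∈ maximalIdeal S' := by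
  rw [IsLocalRing.mem_maximalIdeal, mem_nonunits_iff] at hy ⊢
  intro hu
  apply hy
  rw [isUnit_subring_iff_inv_mem] at hu ⊢
  rw [Subring.coe_inclusion] at hu
  exact ⟨hu.1, hdom.2 _ y.2 hu.2⟩

/-- An element of `S` whose image lies in `𝔪_{S'}` lies in `𝔪_S` (units map to units). [folklore] -/
theorem mem_maximalIdeal_of_inclusion_mem (hle : S ≤ S') {y : S} (hy : Subring.inclusion hle y ∈ maximalIdeal S') :
    y ∈ maximalIdeal S := by
  by_contra h
  rw [IsLocalRing.mem_maximalIdeal, mem_nonunits_iff, not_not] at h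
  exact (IsLocalRing.mem_maximalIdeal _).mp hy (h.map (Subring.inclusion hle))

omit [IsLocalRing S'] in
/-- If `𝔪_S · S' = u · S'` then `S[𝔪_S/u] ⊆ S'`. [folklore] -/
theorem blowupRing_le_of_map_eq_span (hle : S ≤ S') (u : S) (hu0 : (u : L) ≠ 0)
    (hu : (maximalIdeal S).map (Subring.inclusion hle) = Ideal.span {Subring.inclusion hle u}) :
    blowupRing S (u : L) ≤ S' := by
  refine Subring.closure_le.mpr ?_
  rintro y (hy | ⟨g, hg, rfl⟩)
  · exact hle hy
  · obtain ⟨a, ha⟩ := Ideal.mem_span_singleton'.mp (hu ▸ Ideal.mem_map_of_mem (Subring.inclusion hle) hg)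
    have e : ((g : S) : L) = (a : L) * (u : L) := by
      have := congrArg (fun t : S' => (t : L)) ha
      simpa [Subring.coe_inclusion] using this.symm
    change ((g : S) : L) / (u : L) ∈ S'
    rw [e, mul_div_cancel_right₀ _ hu0]
    exact a.2

/-- **One rational free step transports generators.** Let `S ≤ S'` be a quadratic transform of local subrings of a field with
`𝔪_S · S' = u · S'` (the step is in the `u`-chart), `𝔪_S = (u, wᵢ)ᵢ`, and suppose every element of `S'` is congruent modulo `𝔪_{S'}` to the
image of an element of `A ⊆ S` (rational centre, lifts in `A`). Then there are `αᵢ ∈ A` and `wᵢ' ∈ S'` with `wᵢ = u · (αᵢ + wᵢ')` and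
`𝔪_{S'} = (u, wᵢ')ᵢ`. (`T := S + (u, wᵢ')` is a subring containing `S[𝔪_S/u]`; `S' = S[𝔪_S/u]_𝔫` by the chart change
`IsQuadraticTransform.eq_ofPrime_of_le`; numerators in `𝔪_{S'}` have their `S`-part in `𝔪_S ⊆ (u)` by domination.) [folklore] -/
theorem exists_generators_of_rational_step (hqt : IsQuadraticTransform S S') (hle : S ≤ S')
    {ι : Type*} (u : S) (w : ι → S) (hgen : Ideal.span (insert u (Set.range w)) = maximalIdeal S)
    (hu : (maximalIdeal S).map (Subring.inclusion hle) = Ideal.span {Subring.inclusion hle u})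
    (A : Set S) (hrat : ∀ z : S', ∃ s ∈ A, z - Subring.inclusion hle s ∈ maximalIdeal S') :
    ∃ (α : ι → S) (w' : ι → S'), (∀ i, α i ∈ A) ∧
      (∀ i, (w i : L) = (u : L) * ((α i : L) + (w' i : L))) ∧
      Ideal.span (insert (Subring.inclusion hle u) (Set.range w')) = maximalIdeal S' := by
  classical
  set φ := Subring.inclusion hle with hφ
  have hdom : SubringDominates S S' := hqt.dominates
  have hum : u ∈ maximalIdeal S := hgen ▸ Ideal.subset_span (Set.mem_insert _ _)
  have hwm : ∀ i, w i ∈ maximalIdeal S := fun i => hgen ▸ Ideal.subset_span (Set.mem_insert_of_mem _ ⟨i, rfl⟩)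
  -- `u ≠ 0`: the chart element `x` of the transform lies in `𝔪_S · S' = (u)`
  have hu0 : u ≠ 0 := by
    obtain ⟨_, x, hxm, hx0, -⟩ := hqt
    intro h
    apply hx0
    have hx : φ x ∈ Ideal.span {φ u} := hu ▸ Ideal.mem_map_of_mem φ hxm
    rw [h, map_zero, Ideal.span_singleton_eq_bot.mpr rfl, Ideal.mem_bot] at hx
    have := congrArg (fun t : S' => (t : L)) hx
    simp only [hφ, Subring.coe_inclusion, ZeroMemClass.coe_zero] at this
    exact_mod_cast this
  have hu0L : (u : L) ≠ 0 := fun h => hu0 (by exact_mod_cast h)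
  -- `w i / u =: t i ∈ S'`, and rational lifts `α i ∈ A`
  have ht : ∀ i, ∃ t : S', t * φ u = φ (w i) := fun i =>
    Ideal.mem_span_singleton'.mp (hu ▸ Ideal.mem_map_of_mem φ (hwm i))
  choose t ht using ht
  have hα : ∀ i, ∃ a : S, a ∈ A ∧ t i - φ a ∈ maximalIdeal S' := fun i => by
    obtain ⟨s, hs, h⟩ := hrat (t i); exact ⟨s, hs, h⟩
  choose α hαA hα using hα
  have htL : ∀ i, (w i : L) = (t i : L) * (u : L) := fun i => by
    have := congrArg (fun s : S' => (s : L)) (ht i)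
    simpa [hφ, Subring.coe_inclusion] using this.symm
  refine ⟨α, fun i => t i - φ (α i), hαA, fun i => ?_, ?_⟩
  · rw [htL i, AddSubgroupClass.coe_sub, hφ, Subring.coe_inclusion]
    ring
  set J : Ideal S' := Ideal.span (insert (φ u) (Set.range fun i => t i - φ (α i))) with hJ
  -- `J ≤ 𝔪'`
  have hJle : J ≤ maximalIdeal S' := by
    rw [hJ, Ideal.span_le]
    rintro z (rfl | ⟨i, rfl⟩)
    · exact inclusion_mem_maximalIdeal hdom hum
    · exact hα i
  refine le_antisymm hJle ?_
  -- `𝔪' ≤ J`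
  have hBle : blowupRing S (u : L) ≤ S' := blowupRing_le_of_map_eq_span hle u hu0L hu
  have hS' := hqt.eq_ofPrime_of_le hum hu0 (le_refl (blowupRing S (u : L))) hBle
  -- every element of `S[𝔪/u]` is `s + j` with `s ∈ S`, `j ∈ J`
  have hP : ∀ y ∈ blowupRing S (u : L), ∃ (s : S) (j : S'), j ∈ J ∧ y = (s : L) + (j : L) := by
    intro y hy
    rw [blowupRing_eq_closure_of_span_eq (u : L) (insert u (Set.range w)) hgen] at hy
    induction hy using Subring.closure_induction with
    | mem y hy =>
      rcases hy with hy | ⟨g, hg, rfl⟩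
      · exact ⟨⟨y, hy⟩, 0, J.zero_mem, by simp⟩
      · rcases hg with rfl | ⟨i, rfl⟩
        · exact ⟨1, 0, J.zero_mem, by simp [div_self hu0L]⟩
        · refine ⟨α i, t i - φ (α i), Ideal.subset_span (Set.mem_insert_of_mem _ ⟨i, rfl⟩), ?_⟩
          change ((w i : S) : L) / (u : L) = _
          rw [htL i, mul_div_cancel_right₀ _ hu0L, AddSubgroupClass.coe_sub, hφ, Subring.coe_inclusion]
          ring
    | zero => exact ⟨0, 0, J.zero_mem, by simp⟩
    | one => exact ⟨1, 0, J.zero_mem, by simp⟩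
    | add x y _ _ hx hy =>
      obtain ⟨s, j, hj, rfl⟩ := hx
      obtain ⟨s', j', hj', rfl⟩ := hy
      exact ⟨s + s', j + j', J.add_mem hj hj', by push_cast; ring⟩
    | neg x _ hx =>
      obtain ⟨s, j, hj, rfl⟩ := hx
      exact ⟨-s, -j, J.neg_mem hj, by push_cast; ring⟩
    | mul x y _ _ hx hy =>
      obtain ⟨s, j, hj, rfl⟩ := hx
      obtain ⟨s', j', hj', rfl⟩ := hy
      refine ⟨s * s', φ s * j' + φ s' * j + j * j',
        J.add_mem (J.add_mem (J.mul_mem_left _ hj') (J.mul_mem_left _ hj)) (J.mul_mem_left _ hj'), ?_⟩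
      push_cast [hφ, Subring.coe_inclusion]
      ring
  intro z hz
  have hzmem : ((z : S') : L) ∈ (LocalSubring.ofPrime (blowupRing S (u : L))
      ((maximalIdeal S').comap (Subring.inclusion hBle))).toSubring := hS' ▸ z.2
  obtain ⟨a, s₂, hs₂, hz'⟩ := mem_ofPrime_iff.mp hzmem
  obtain ⟨sa, ja, hja, ha⟩ := hP a a.2
  have hs₂0 : ((s₂ : blowupRing S (u : L)) : L) ≠ 0 := coe_ne_zero_of_not_mem hs₂
  have hs₂inv : ((s₂ : blowupRing S (u : L)) : L)⁻¹ ∈ S' := inv_mem_of_not_mem_comap hBle hs₂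
  -- the numerator `a = z · s₂` lies in `𝔪'`, so its `S`-part lies in `𝔪_S ⊆ (u) ⊆ J`
  set a' : S' := Subring.inclusion hBle a with ha'
  have has : a' = z * Subring.inclusion hBle s₂ := Subtype.ext (by
    change ((a : blowupRing S (u : L)) : L) = (z : L) * ((s₂ : blowupRing S (u : L)) : L)
    rw [hz', div_mul_cancel₀ _ hs₂0])
  have ha'm : a' ∈ maximalIdeal S' := has ▸ Ideal.mul_mem_right _ _ hz
  have ha'eq : a' = φ sa + ja := Subtype.ext (by
    change ((a : blowupRing S (u : L)) : L) = _
    rw [ha, Subring.coe_add, hφ, Subring.coe_inclusion])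
  have hsa' : φ sa ∈ maximalIdeal S' := by
    have : φ sa = a' - ja := by rw [ha'eq, add_sub_cancel_right]
    rw [this]
    exact Ideal.sub_mem _ ha'm (hJle hja)
  have hsa : sa ∈ maximalIdeal S := mem_maximalIdeal_of_inclusion_mem hle hsa'
  have hsaJ : φ sa ∈ J := by
    have h1 : φ sa ∈ Ideal.span {φ u} := hu ▸ Ideal.mem_map_of_mem φ hsa
    exact Ideal.span_mono (Set.singleton_subset_iff.mpr (Set.mem_insert _ _)) h1
  have ha'J : a' ∈ J := ha'eq ▸ J.add_mem hsaJ hja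
  -- `z = a' · s₂⁻¹ ∈ J`
  have hz'' : z = a' * ⟨((s₂ : blowupRing S (u : L)) : L)⁻¹, hs₂inv⟩ := Subtype.ext (by
    change (z : L) = ((a : blowupRing S (u : L)) : L) * ((s₂ : blowupRing S (u : L)) : L)⁻¹
    rw [hz', div_eq_mul_inv])
  rw [hz'']
  exact Ideal.mul_mem_right _ _ ha'J

end OneStep

/-! ## Chains: iterated rationality, the persistent parameter, coordinates, telescoping -/

section Chain

variable (S : ℕ → Subring L) [∀ m, IsLocalRing (S m)] (hle : ∀ m, S m ≤ S (m + 1))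

omit [∀ m, IsLocalRing (S m)] in
/-- `S` is monotone. -/
theorem monotone (hle : ∀ m, S m ≤ S (m + 1)) : Monotone S := monotone_nat_of_le_succ hle

omit [∀ m, IsLocalRing (S m)] in
/-- Inclusions compose (all are the identity on the underlying field element). -/
theorem inclusion_inclusion {m n k : ℕ} (h₁ : S m ≤ S n) (h₂ : S n ≤ S k) (h₃ : S m ≤ S k) (y : S m) :
    Subring.inclusion h₂ (Subring.inclusion h₁ y) = Subring.inclusion h₃ y := Subtype.ext rfl

include hle in
/-- **Rationality iterates**: if every stage-`(m+1)` element is congruent mod `𝔪_{m+1}` to a stage-`m` element (and each step is dominant), then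
every stage-`m` element is congruent mod `𝔪_m` to a stage-`0` element. [folklore] -/
theorem exists_sub_mem_maximalIdeal_of_rational (hdom : ∀ m, SubringDominates (S m) (S (m + 1)))
    (hrat : ∀ m (z : S (m + 1)), ∃ s : S m, z - Subring.inclusion (hle m) s ∈ maximalIdeal (S (m + 1))) :
    ∀ m (z : S m), ∃ s : S 0, z - Subring.inclusion (monotone S hle (Nat.zero_le m)) s ∈ maximalIdeal (S m) := by
  intro m
  induction m with
  | zero => intro z; exact ⟨z, by rw [show Subring.inclusion _ z = z from Subtype.ext rfl, sub_self]; exact zero_mem _⟩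
  | succ m ih =>
    intro z
    obtain ⟨s₁, hs₁⟩ := hrat m z
    obtain ⟨s₀, hs₀⟩ := ih s₁
    refine ⟨s₀, ?_⟩
    have h2 : Subring.inclusion (hle m) (s₁ - Subring.inclusion (monotone S hle (Nat.zero_le m)) s₀) ∈ maximalIdeal (S (m + 1)) :=
      inclusion_mem_maximalIdeal (hdom m) hs₀
    rw [map_sub, inclusion_inclusion S] at h2
    have := Ideal.add_mem _ hs₁ h2
    rwa [sub_add_sub_cancel] at this

omit [∀ m, IsLocalRing (S m)] in
include hle in
/-- **The first exceptional parameter persists along a free chain**: if `𝔪_m · S (m+1) = (x m)`, `(x m) = (x (m+1))` in `S (m+2)` for all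
`m`, and `(x 0) = (u)` in `S 1` for `u ∈ S 0`, then `(x m) = (u)` and `𝔪_m · S (m+1) = (u)` in `S (m+1)` for every `m`. [folklore] -/
theorem span_excParam_eq_of_free (x : ∀ m, S (m + 1)) (u : S 0)
    (hx0 : Ideal.span {x 0} = Ideal.span {Subring.inclusion (hle 0) u})
    (hfree : ∀ m, Ideal.span {Subring.inclusion (hle (m + 1)) (x m)} = Ideal.span {x (m + 1)}) :
    ∀ m, Ideal.span {x m} = Ideal.span {Subring.inclusion (monotone S hle (Nat.zero_le (m + 1))) u} := by
  intro m
  induction m with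
  | zero => rw [hx0]
  | succ m ih =>
    rw [← hfree m]
    have := congrArg (Ideal.map (Subring.inclusion (hle (m + 1)))) ih
    rwa [Ideal.map_span, Ideal.map_span, Set.image_singleton, Set.image_singleton, inclusion_inclusion S] at this

/-- Bookkeeping: two families that agree modulo `(u)` generate, together with `u`, the same ideal. [folklore] -/
theorem span_insert_eq_of_sub_mem {R : Type*} [CommRing R] {ι : Type*} (u : R) (a b : ι → R)
    (h : ∀ i, a i - b i ∈ Ideal.span {u}) :
    Ideal.span (insert u (Set.range a)) = Ideal.span (insert u (Set.range b)) := by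
  have key : ∀ (a b : ι → R), (∀ i, a i - b i ∈ Ideal.span {u}) →
      Ideal.span (insert u (Set.range a)) ≤ Ideal.span (insert u (Set.range b)) := by
    intro a b h
    rw [Ideal.span_le]
    rintro z (hz | ⟨i, rfl⟩)
    · rw [hz]; exact Ideal.subset_span (Set.mem_insert _ _)
    · have h1 : a i - b i ∈ Ideal.span (insert u (Set.range b)) :=
        Ideal.span_mono (Set.singleton_subset_iff.mpr (Set.mem_insert _ _)) (h i)
      have h2 : b i ∈ Ideal.span (insert u (Set.range b)) := Ideal.subset_span (Set.mem_insert_of_mem _ ⟨i, rfl⟩)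
      have := Ideal.add_mem _ h1 h2
      rwa [sub_add_cancel] at this
  refine le_antisymm (key a b h) (key b a fun i => ?_)
  rw [← neg_sub]
  exact neg_mem (h i)

include hle in
/-- **Free-chain coordinates: the truncated arc is algebraic.** Along a chain of quadratic transforms with `𝔪_m · S (m+1) = (u)` for all `m`
(all steps free, persistent parameter `u ∈ S 0`) and rational centres (`hrat`), starting from generators `𝔪₀ = (u, wᵢ)ᵢ`: for every `M` there are
`ỹᵢ ∈ S 0` and `wᵢ^{(M)} ∈ S M` with `𝔪₀ = (u, ỹᵢ)ᵢ`, `𝔪_M = (u, wᵢ^{(M)})ᵢ` and `ỹᵢ = u^M · wᵢ^{(M)}`. [folklore] -/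
theorem exists_coordinates (hqt : ∀ m, IsQuadraticTransform (S m) (S (m + 1))) (u : S 0) {ι : Type*} (w : ι → S 0)
    (hgen : Ideal.span (insert u (Set.range w)) = maximalIdeal (S 0))
    (hmu : ∀ m, (maximalIdeal (S m)).map (Subring.inclusion (hle m)) =
      Ideal.span {Subring.inclusion (monotone S hle (Nat.zero_le (m + 1))) u})
    (hrat : ∀ m (z : S (m + 1)), ∃ s : S m, z - Subring.inclusion (hle m) s ∈ maximalIdeal (S (m + 1))) (M : ℕ) :
    ∃ (yt : ι → S 0) (wM : ι → S M),
      Ideal.span (insert u (Set.range yt)) = maximalIdeal (S 0) ∧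
      Ideal.span (insert (Subring.inclusion (monotone S hle (Nat.zero_le M)) u) (Set.range wM)) = maximalIdeal (S M) ∧
      ∀ i, (yt i : L) = (u : L) ^ M * (wM i : L) := by
  have hdom : ∀ m, SubringDominates (S m) (S (m + 1)) := fun m => (hqt m).dominates
  have hrat0 := exists_sub_mem_maximalIdeal_of_rational S hle hdom hrat
  induction M with
  | zero =>
    refine ⟨w, w, hgen, ?_, fun i => by rw [pow_zero, one_mul]⟩
    rw [show Subring.inclusion _ u = u from Subtype.ext rfl, hgen]
  | succ M ih =>
    obtain ⟨yt, wM, hgen0, hgenM, hrel⟩ := ih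
    -- one rational free step `S M ≤ S (M+1)` with lifts in the image of `S 0`
    have hratA : ∀ z : S (M + 1), ∃ s ∈ Set.range (Subring.inclusion (monotone S hle (Nat.zero_le M))),
        z - Subring.inclusion (hle M) s ∈ maximalIdeal (S (M + 1)) := by
      intro z
      obtain ⟨s₀, hs₀⟩ := hrat0 (M + 1) z
      exact ⟨_, ⟨s₀, rfl⟩, by rwa [inclusion_inclusion S]⟩
    obtain ⟨α, w', hαA, hαrel, hgen'⟩ := exists_generators_of_rational_step (hqt M) (hle M) _ wM hgenM (hmu M) _ hratA
    choose β hβ using hαA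
    refine ⟨fun i => yt i - u ^ (M + 1) * β i, w', ?_, ?_, fun i => ?_⟩
    · rw [← hgen0]
      refine span_insert_eq_of_sub_mem u _ _ fun i => ?_
      rw [sub_sub_cancel_left, neg_mem_iff, pow_succ, mul_assoc]
      exact Ideal.mul_mem_left _ _ (Ideal.mul_mem_right _ _ (Ideal.mem_span_singleton_self u))
    · rwa [inclusion_inclusion S] at hgen'
    · have e1 := hαrel i
      rw [← hβ i, Subring.coe_inclusion, Subring.coe_inclusion] at e1
      push_cast
      rw [hrel i, e1]
      ring

omit [∀ m, IsLocalRing (S m)] in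
include hle in
/-- **The law telescopes** (characteristic `2`, even exponent): if `f (m+1) · (x m)^(2e) = f m − (g m)²` in `L` and `(x m) = (u)` in `S (m+1)` for all
`m`, then for every `M` there are `Ψ, E ∈ S M` with `f 0 = Ψ² + u^(2e·M) · E² · f M` (a sum of squares is a square; the units `x m / u` collect in `E`).
[folklore] -/
theorem exists_telescope [CharP L 2] (f g : ∀ m, S m) (x : ∀ m, S (m + 1)) (u : S 0) (e : ℕ)
    (hlaw : ∀ m, ((f (m + 1) : S (m + 1)) : L) * ((x m : S (m + 1)) : L) ^ (2 * e) = ((f m : S m) : L) - ((g m : S m) : L) ^ 2)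
    (hxu : ∀ m, Ideal.span {x m} = Ideal.span {Subring.inclusion (monotone S hle (Nat.zero_le (m + 1))) u}) (M : ℕ) :
    ∃ Ψ E : S M, ((f 0 : S 0) : L) = (Ψ : L) ^ 2 + (u : L) ^ (2 * e * M) * (E : L) ^ 2 * ((f M : S M) : L) := by
  induction M with
  | zero => exact ⟨0, 1, by simp⟩
  | succ M ih =>
    obtain ⟨Ψ, E, hΨ⟩ := ih
    -- `x M = u · ε` with `ε ∈ S (M+1)`
    obtain ⟨ε, hε⟩ := Ideal.mem_span_singleton'.mp ((hxu M) ▸ Ideal.mem_span_singleton_self (x M))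
    have hεL : ((x M : S (M + 1)) : L) = (ε : L) * (u : L) := by
      have := congrArg (fun s : S (M + 1) => (s : L)) hε
      simpa [Subring.coe_inclusion] using this.symm
    have hM := hlaw M
    rw [hεL] at hM
    refine ⟨Subring.inclusion (hle M) Ψ + Subring.inclusion (monotone S hle (Nat.zero_le (M + 1))) u ^ (e * M) *
        Subring.inclusion (hle M) E * Subring.inclusion (hle M) (g M),
      Subring.inclusion (hle M) E * ε ^ e, ?_⟩
    push_cast [Subring.coe_inclusion]
    rw [CharTwo.add_sq, hΨ]
    have hfM : ((f M : S M) : L) = ((g M : S M) : L) ^ 2 + ((f (M + 1) : S (M + 1)) : L) * ((ε : L) * (u : L)) ^ (2 * e) := by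
      rw [hM]; ring
    rw [hfM]
    ring

/-- **Bookkeeping: one member of a generating family generates the extended ideal.** If `𝔪_S = (vₖ)ₖ` and `𝔪_S · S' = (x)` is principal in the
local domain `S'`, then `(x) = (vₖ)` for some `k` (if every `vₖ/x` were a non-unit, `x ∈ 𝔪_{S'}·x` would force `x = 0`). [folklore] -/
theorem exists_generator_eq_span {S S' : Subring L} [IsLocalRing S] [IsLocalRing S'] (hle : S ≤ S') {n : ℕ} (v : Fin (n + 1) → S)
    (hv : Ideal.span (Set.range v) = maximalIdeal S) (x : S')
    (hx : (maximalIdeal S).map (Subring.inclusion hle) = Ideal.span {x}) :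
    ∃ k, Ideal.span {x} = Ideal.span {Subring.inclusion hle (v k)} := by
  classical
  set φ := Subring.inclusion hle with hφ
  have hmap : (maximalIdeal S).map φ = Ideal.span (Set.range (φ ∘ v)) := by
    rw [← hv, Ideal.map_span, Set.range_comp]
  -- each `φ (v k) = a k * x`
  have ha : ∀ k, ∃ a : S', a * x = φ (v k) := fun k =>
    Ideal.mem_span_singleton'.mp (hx ▸ Ideal.mem_map_of_mem φ (hv ▸ Ideal.subset_span ⟨k, rfl⟩))
  choose a ha using ha
  -- `x = Σ c k · φ (v k)`
  have hxmem : x ∈ Ideal.span (Set.range (φ ∘ v)) := hmap ▸ hx ▸ Ideal.mem_span_singleton_self x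
  obtain ⟨c, hc⟩ := Ideal.mem_span_range_iff_exists_fun.mp hxmem
  by_cases hunit : ∃ k, IsUnit (a k)
  · obtain ⟨k, hk⟩ := hunit
    refine ⟨k, ?_⟩
    rw [← ha k]
    exact (Ideal.span_singleton_mul_left_unit hk x).symm
  · push Not at hunit
    -- then `x = (Σ c k a k) x` with `Σ c k a k ∈ 𝔪'`, so `x = 0`, and every `φ (v k) = 0`
    have hsum : (∑ k, c k * a k) * x = x := by
      rw [Finset.sum_mul]
      conv_rhs => rw [← hc]
      refine Finset.sum_congr rfl fun k _ => ?_
      rw [mul_assoc, ha k, Function.comp_apply]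
    have hm : ∑ k, c k * a k ∈ maximalIdeal S' :=
      Ideal.sum_mem _ fun k _ => Ideal.mul_mem_left _ _ ((IsLocalRing.mem_maximalIdeal _).mpr (hunit k))
    have hx0 : x = 0 := by
      have h1 : (∑ k, c k * a k - 1) * x = 0 := by rw [sub_mul, one_mul, hsum, sub_self]
      rcases mul_eq_zero.mp h1 with h | h
      · exact absurd (sub_eq_zero.mp h ▸ hm) (IsLocalRing.notMem_maximalIdeal.mpr isUnit_one)
      · exact h
    refine ⟨0, ?_⟩
    rw [hx0, ← ha 0, hx0, mul_zero]

end Chain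

end Summit.ResolutionOfSingularities.ResolutionOfSingularities.Theorems.SwitchingDichotomy.FreeChain

end
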